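import Literature.MathematicalPhysics.QuantumFieldTheory.ConstructiveQFTWave0Proofs
import Literature.MathematicalPhysics.QuantumFieldTheory.LatticeSiteRPMechanism
import HarnessLib

/-!
# Reflection positivity of the Wilson lattice gauge theory in hyperplanes through sites

Theorem-only companion of `ConstructiveQFTWave0Proofs`. That file proves Osterwalder–Seiler
reflection positivity of the torus Wilson measure `μ_{Λ,β}` on `(ℤ/Lℤ)^d`, `L` even, for the
reflection `θ t = 1 - t` in the two hyperplanes BETWEEN time slices (`t = 1/2`, `t = (L+1)/2`).
Here we prove the companion statement for the reflection `θ' t = -t` in the two hyperplanes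
THROUGH the time slices `t = 0` and `t = L/2` ("reflection through sites", the part of inventory
item constructive-qft.S13 recorded as absent in `ConstructiveQFTWave0`): for every bounded
measurable observable `F` depending only on the links of the closed positive-time half
`0 ≤ t ≤ L/2` (positive links `P'` and the spatial links `M` lying in the two hyperplanes),
`⟨conj F(Θ'U) · F(U)⟩_{Λ,β} ≥ 0`, for EVERY real `β` (no character expansion is involved: each
plaquette lies on one side of a lattice hyperplane or inside it).

The two reflections are genuinely different (they are not conjugate under lattice symmetries of
the even torus), and both are needed for the transfer-matrix bound on Wilson loops: `θ` bisects
the loops of odd time extent, `θ'` those of even time extent (Seiler LNP 159 §2).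

## The argument

With `A'(U) = ∑_{p positive} Re tr ρ(U_p)` (plaquettes in the open slab `0 < t < L/2` or touching
it), `S_M(U) = ∑_{p shared} Re tr ρ(U_p)` (spatial plaquettes inside the two hyperplanes) one has
`∑ₚ Re tr ρ(U_p) = A'(U) + A'(Θ'U) + S_M(U)` (`sum_plaqRe_eq_site`), `A'` depends on `P' ∪ M`, `S_M`
on `M`, and `Θ'` fixes the links in `M`. Hence
`e^{-βS} conj F(Θ'U) F(U) = e^{-βN#plaq} g(U) conj g(Θ'U)` with
`g = F · e^{βA'} · e^{βS_M/2}` depending on `P' ∪ M` (`siteIntegrand_eq`), and the abstract lemma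
with a shared block `LatticeRP.integral_splice_mul_conj_comp_of_shared_nonneg` (conditioning on
`M`, independence of the two halves, `Θ'`-invariance of product Haar measure) gives positivity.
Measurability is handled without second countability of `G` exactly as in the parent file
(`WilsonRP.EntryMeasurable`).

## Main result

* `wilsonExpectation_siteReflectionPositive`: `0 ≤ ⟨conj F(Θ'U) F(U)⟩_{Λ,β}` for `L` even,
  continuous `ρ`, any real `β`, and `F` bounded measurable depending on
  `WilsonSiteRP.sitePosEdges ∪ WilsonSiteRP.sharedEdges`.

References: K. Osterwalder, E. Seiler, Ann. Phys. 110 (1978) 440, §2; E. Seiler, LNP 159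
(1982), Ch. 2; J. Fröhlich, R. Israel, E. Lieb, B. Simon, Comm. Math. Phys. 62 (1978) 1,
Thm. 2.1 (reflection through sites). All statements here are proved. [folklore]
-/

open MeasureTheory Finset Complex
open scoped ComplexOrder ENNReal ComplexConjugate

namespace Literature.MathematicalPhysics.QuantumFieldTheory

noncomputable section

/-! ## The site reflection `θ' t = -t` -/

section Defs

variable {d L : ℕ} {G : Type*}

/-- Time reflection of sites in the hyperplanes through the time slices `t = 0` and `t = L/2`:
`θ'(t, x⃗) = (-t, x⃗)`, time being coordinate `0` (Osterwalder–Seiler 1978 §2, reflection in a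
lattice hyperplane). [folklore] -/
def Site.negReflect [NeZero d] (x : Site d L) : Site d L :=
  Function.update x 0 (-x 0)

/-- The induced reflection `Θ'` on gauge configurations: spatial links are carried along, and the
temporal link `x → x + e₀` goes to the reversed temporal link `θ'(x + e₀) → θ'x`, whence the
inverse (Osterwalder–Seiler 1978 §2; Seiler LNP 159 Ch. 2). [folklore] -/
def GaugeConfig.negReflect [Group G] [NeZero d] (U : GaugeConfig d L G) : GaugeConfig d L G :=
  fun e => if e.2 = 0 then (U ((e.1.shift 0).negReflect, 0))⁻¹ else U (e.1.negReflect, e.2)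

end Defs

namespace WilsonSiteRP

open WilsonRP

/-! ## Lattice geometry of the site reflection -/

section Sites

variable {d L : ℕ} [NeZero d]

/-- The time coordinate of the reflected site. [folklore] -/
@[simp] theorem negReflect_apply_zero (x : Site d L) : x.negReflect 0 = -x 0 := by
  simp [Site.negReflect]

/-- The reflection does not change the spatial coordinates. [folklore] -/
theorem negReflect_apply_of_ne (x : Site d L) {k : Fin d} (h : k ≠ 0) : x.negReflect k = x k := by
  simp [Site.negReflect, h]

/-- The site reflection is an involution. [folklore] -/
@[simp] theorem negReflect_negReflect (x : Site d L) : x.negReflect.negReflect = x := by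
  funext k
  by_cases hk : k = 0
  · subst hk; simp
  · simp [negReflect_apply_of_ne _ hk]

/-- Reflection commutes with spatial shifts. [folklore] -/
theorem negReflect_shift_of_ne (x : Site d L) {i : Fin d} (hi : i ≠ 0) :
    (x.shift i).negReflect = x.negReflect.shift i := by
  funext k
  by_cases hk : k = 0
  · subst hk
    rw [negReflect_apply_zero, shift_apply_of_ne _ (Ne.symm hi), shift_apply_of_ne _ (Ne.symm hi),
      negReflect_apply_zero]
  · rw [negReflect_apply_of_ne _ hk]
    by_cases hki : k = i
    · subst hki
      rw [shift_apply_self, shift_apply_self, negReflect_apply_of_ne _ hk]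
    · rw [shift_apply_of_ne _ hki, shift_apply_of_ne _ hki, negReflect_apply_of_ne _ hk]

/-- `θ'(θ'(x + e₀) + e₀) = x`: the reflection of temporal links is an involution. [folklore] -/
@[simp] theorem negReflect_shift_negReflect_shift (x : Site d L) :
    ((x.shift 0).negReflect.shift 0).negReflect = x := by
  funext k
  by_cases hk : k = 0
  · subst hk
    simp only [negReflect_apply_zero, shift_apply_self]
    ring
  · rw [negReflect_apply_of_ne _ hk, shift_apply_of_ne _ hk, negReflect_apply_of_ne _ hk,
      shift_apply_of_ne _ hk]

/-- `θ'(x + e₀) + e₀ = θ' x`. [folklore] -/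
theorem negReflect_shift_shift (x : Site d L) :
    (x.shift 0).negReflect.shift 0 = x.negReflect := by
  funext k
  by_cases hk : k = 0
  · subst hk
    simp only [negReflect_apply_zero, shift_apply_self]
    ring
  · rw [shift_apply_of_ne _ hk, negReflect_apply_of_ne _ hk, negReflect_apply_of_ne _ hk,
      shift_apply_of_ne _ hk]

/-- `θ'(x + eⱼ + e₀) = θ'(x + e₀) + eⱼ` for a spatial direction `j`. [folklore] -/
theorem negReflect_shift_shift_zero (x : Site d L) {j : Fin d} (hj : j ≠ 0) :
    ((x.shift j).shift 0).negReflect = (x.shift 0).negReflect.shift j := by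
  rw [shift_comm, negReflect_shift_of_ne _ hj]

/-- On the two reflection hyperplanes (`2t = 0`) the reflection fixes the site. [folklore] -/
theorem negReflect_of_two_mul {x : Site d L} (h : x 0 + x 0 = 0) : x.negReflect = x := by
  funext k
  by_cases hk : k = 0
  · subst hk
    simp only [negReflect_apply_zero]
    linear_combination -h
  · rw [negReflect_apply_of_ne _ hk]

end Sites

/-! ## Time arithmetic -/

section Val

variable {d L : ℕ} [NeZero d] [NeZero L] [Fact (1 < L)]

omit [Fact (1 < L)] in
/-- Time coordinate of `θ' x` (it is `-t`). [folklore] -/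
theorem val_negReflect (x : Site d L) :
    (x.negReflect 0).val = if (x 0).val = 0 then 0 else L - (x 0).val := by
  rw [negReflect_apply_zero, ZMod.neg_val]
  by_cases h0 : x 0 = 0
  · have hv : (x 0).val = 0 := by rw [h0, ZMod.val_zero]
    rw [if_pos h0, if_pos hv]
  · have hv : (x 0).val ≠ 0 := fun h => h0 ((ZMod.val_eq_zero _).1 h)
    rw [if_neg h0, if_neg hv]

/-- Time coordinate of `θ'(x + e₀)` (it is `-t-1`). [folklore] -/
theorem val_negReflect_shift_zero (x : Site d L) :
    ((x.shift 0).negReflect 0).val = if (x 0).val + 1 = L then 0 else L - ((x 0).val + 1) := by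
  rw [negReflect_apply_zero, shift_apply_self, ZMod.neg_val]
  have hlt := ZMod.val_lt (x 0)
  by_cases h : (x 0).val + 1 = L
  · have h0 : x 0 + 1 = 0 := by
      have h' : ((x 0).val : ZMod L) + 1 = (((x 0).val + 1 : ℕ) : ZMod L) := by push_cast; ring
      rw [← ZMod.natCast_zmod_val (x 0), h', h, ZMod.natCast_self]
    rw [if_pos h0, if_pos h]
  · have hval : (x 0 + 1).val = (x 0).val + 1 := by
      rw [ZMod.val_add, ZMod.val_one, Nat.mod_eq_of_lt (by omega)]
    have h0 : x 0 + 1 ≠ 0 := by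
      intro h0
      rw [h0, ZMod.val_zero] at hval
      omega
    rw [if_neg h0, if_neg h, hval]

end Val

/-! ## Classification of links and plaquettes -/

section Classification

variable {d L : ℕ} [NeZero d]

/-- Positive links: temporal links `t → t + 1` with `t < L/2`, spatial links in the open slab
`0 < t < L/2`. [folklore] -/
def IsSitePosEdge (e : Edge d L) : Prop :=
  if e.2 = 0 then (e.1 0).val < L / 2 else 1 ≤ (e.1 0).val ∧ (e.1 0).val < L / 2

/-- Shared links: spatial links inside the two reflection hyperplanes `t = 0`, `t = L/2`
(they are fixed by `Θ'`). [folklore] -/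
def IsSharedEdge (e : Edge d L) : Prop := e.2 ≠ 0 ∧ ((e.1 0).val = 0 ∨ (e.1 0).val = L / 2)

/-- Positive plaquettes: temporal plaquettes based at `t < L/2` and spatial plaquettes in the open
slab `0 < t < L/2` (all their links are positive or shared). [folklore] -/
def IsSitePosPlaq (p : Plaquette d L) : Prop :=
  if p.2.1.1 = 0 then (p.1 0).val < L / 2 else 1 ≤ (p.1 0).val ∧ (p.1 0).val < L / 2

/-- Shared plaquettes: spatial plaquettes inside the two reflection hyperplanes. [folklore] -/
def IsSharedPlaq (p : Plaquette d L) : Prop :=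
  p.2.1.1 ≠ 0 ∧ ((p.1 0).val = 0 ∨ (p.1 0).val = L / 2)

/-- Negative plaquettes: the remaining ones. [folklore] -/
def IsSiteNegPlaq (p : Plaquette d L) : Prop := ¬ IsSitePosPlaq p ∧ ¬ IsSharedPlaq p

/-- `IsSitePosEdge` is decidable. -/
instance : DecidablePred (IsSitePosEdge (d := d) (L := L)) := fun _ => by
  unfold IsSitePosEdge; infer_instance

/-- `IsSharedEdge` is decidable. -/
instance : DecidablePred (IsSharedEdge (d := d) (L := L)) := fun _ => by
  unfold IsSharedEdge; infer_instance

/-- `IsSitePosPlaq` is decidable. -/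
instance : DecidablePred (IsSitePosPlaq (d := d) (L := L)) := fun _ => by
  unfold IsSitePosPlaq; infer_instance

/-- `IsSharedPlaq` is decidable. -/
instance : DecidablePred (IsSharedPlaq (d := d) (L := L)) := fun _ => by
  unfold IsSharedPlaq; infer_instance

/-- `IsSiteNegPlaq` is decidable. -/
instance : DecidablePred (IsSiteNegPlaq (d := d) (L := L)) := fun _ => by
  unfold IsSiteNegPlaq; infer_instance

/-- The reflection on (positively oriented) links. [folklore] -/
def siteEdgeReflect (e : Edge d L) : Edge d L :=
  if e.2 = 0 then ((e.1.shift 0).negReflect, 0) else (e.1.negReflect, e.2)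

/-- The reflection on plaquettes. [folklore] -/
def sitePlaqReflect (p : Plaquette d L) : Plaquette d L :=
  (if p.2.1.1 = 0 then (p.1.shift 0).negReflect else p.1.negReflect, p.2)

/-- `GaugeConfig.negReflect` in terms of `siteEdgeReflect`. [folklore] -/
theorem negReflect_apply {G : Type*} [Group G] (U : GaugeConfig d L G) (e : Edge d L) :
    U.negReflect e = if e.2 = 0 then (U (siteEdgeReflect e))⁻¹ else U (siteEdgeReflect e) := by
  unfold GaugeConfig.negReflect siteEdgeReflect
  split_ifs <;> rfl

/-- `siteEdgeReflect` is an involution. [folklore] -/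
theorem siteEdgeReflect_siteEdgeReflect (e : Edge d L) : siteEdgeReflect (siteEdgeReflect e) = e := by
  obtain ⟨x, i⟩ := e
  unfold siteEdgeReflect
  by_cases hi : i = 0
  · subst hi; simp
  · simp [hi]

/-- `sitePlaqReflect` is an involution. [folklore] -/
theorem sitePlaqReflect_sitePlaqReflect (p : Plaquette d L) : sitePlaqReflect (sitePlaqReflect p) = p := by
  obtain ⟨x, ij⟩ := p
  unfold sitePlaqReflect
  by_cases hi : ij.1.1 = 0
  · simp [hi]
  · simp [hi]

/-- `sitePlaqReflect` as a permutation of the plaquettes. [folklore] -/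
def sitePlaqReflectEquiv : Equiv.Perm (Plaquette d L) :=
  Function.Involutive.toPerm sitePlaqReflect sitePlaqReflect_sitePlaqReflect

/-- `siteEdgeReflect` as a permutation of the links. [folklore] -/
def siteEdgeReflectEquiv : Equiv.Perm (Edge d L) :=
  Function.Involutive.toPerm siteEdgeReflect siteEdgeReflect_siteEdgeReflect

variable [NeZero L] [Fact (1 < L)]

/-- The reflection of a positive link is not positive. [folklore] -/
theorem not_isSitePosEdge_siteEdgeReflect (hL : Even L) {e : Edge d L} (he : IsSitePosEdge e) :
    ¬ IsSitePosEdge (siteEdgeReflect e) := by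
  obtain ⟨x, i⟩ := e
  have hlt := ZMod.val_lt (x 0)
  have h1L : 1 < L := Fact.out
  have hE := Nat.even_iff.mp hL
  unfold IsSitePosEdge at he ⊢
  unfold siteEdgeReflect
  by_cases hi : i = 0
  · subst hi
    simp only [↓reduceIte] at he ⊢
    rw [val_negReflect_shift_zero]
    split_ifs <;> omega
  · simp only [hi, ↓reduceIte] at he ⊢
    rw [val_negReflect]
    split_ifs <;> omega

omit [Fact (1 < L)] in
/-- Shared links are fixed by the reflection. [folklore] -/
theorem siteEdgeReflect_of_isSharedEdge (hL : Even L) {e : Edge d L} (he : IsSharedEdge e) :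
    siteEdgeReflect e = e := by
  obtain ⟨x, i⟩ := e
  obtain ⟨hi, ht⟩ := he
  simp only at hi ht
  unfold siteEdgeReflect
  rw [if_neg hi, negReflect_of_two_mul (two_mul_eq_zero_of_val hL ht)]

omit [NeZero L] [Fact (1 < L)] in
/-- Shared links are not positive. [folklore] -/
theorem not_isSitePosEdge_of_isSharedEdge {e : Edge d L} (he : IsSharedEdge e) : ¬ IsSitePosEdge e := by
  obtain ⟨hi, ht⟩ := he
  unfold IsSitePosEdge
  rw [if_neg hi]
  omega

omit [NeZero L] [Fact (1 < L)] in
/-- Shared plaquettes are not positive. [folklore] -/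
theorem not_isSitePosPlaq_of_isSharedPlaq {p : Plaquette d L} (hp : IsSharedPlaq p) : ¬ IsSitePosPlaq p := by
  obtain ⟨hi, ht⟩ := hp
  unfold IsSitePosPlaq
  rw [if_neg hi]
  omega

/-- The reflection exchanges positive and negative plaquettes. [folklore] -/
theorem isSiteNegPlaq_sitePlaqReflect_iff (hL : Even L) (p : Plaquette d L) :
    IsSiteNegPlaq (sitePlaqReflect p) ↔ IsSitePosPlaq p := by
  obtain ⟨x, ij⟩ := p
  have hlt := ZMod.val_lt (x 0)
  have h1L : 1 < L := Fact.out
  have hE := Nat.even_iff.mp hL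
  unfold IsSiteNegPlaq IsSitePosPlaq IsSharedPlaq sitePlaqReflect
  by_cases hi : ij.1.1 = 0
  · simp only [hi, ↓reduceIte, ne_eq, not_true_eq_false, false_and, not_false_eq_true, and_true]
    rw [val_negReflect_shift_zero]
    split_ifs <;> omega
  · simp only [hi, ↓reduceIte, ne_eq, not_false_eq_true, true_and]
    rw [val_negReflect]
    split_ifs <;> omega

end Classification

/-! ## The finsets `P'`, `M`; links of positive and shared plaquettes -/

section Classification2

variable {d L : ℕ} [NeZero d] [NeZero L] [Fact (1 < L)]

/-- The finset `P'` of positive links. [folklore] -/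
def sitePosEdges : Finset (Edge d L) := univ.filter IsSitePosEdge

/-- The finset `M` of shared links. [folklore] -/
def sharedEdges : Finset (Edge d L) := univ.filter IsSharedEdge

omit [Fact (1 < L)] in
/-- Membership in `P'`. [folklore] -/
@[simp] theorem mem_sitePosEdges {e : Edge d L} : e ∈ sitePosEdges ↔ IsSitePosEdge e := by
  simp [sitePosEdges]

omit [Fact (1 < L)] in
/-- Membership in `M`. [folklore] -/
@[simp] theorem mem_sharedEdges {e : Edge d L} : e ∈ sharedEdges ↔ IsSharedEdge e := by
  simp [sharedEdges]

omit [Fact (1 < L)] in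
/-- `M` and `P'` are disjoint. [folklore] -/
theorem disjoint_sharedEdges_sitePosEdges :
    Disjoint (sharedEdges : Finset (Edge d L)) sitePosEdges := by
  rw [Finset.disjoint_left]
  intro e he hp
  rw [mem_sharedEdges] at he
  rw [mem_sitePosEdges] at hp
  exact not_isSitePosEdge_of_isSharedEdge he hp

/-- The four links of a positive plaquette are positive or shared. [folklore] -/
theorem edges_of_isSitePosPlaq (hL : Even L) {p : Plaquette d L} (hp : IsSitePosPlaq p) :
    (IsSitePosEdge (p.1, p.2.1.1) ∨ IsSharedEdge (p.1, p.2.1.1)) ∧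
      (IsSitePosEdge (p.1.shift p.2.1.1, p.2.1.2) ∨ IsSharedEdge (p.1.shift p.2.1.1, p.2.1.2)) ∧
      (IsSitePosEdge (p.1.shift p.2.1.2, p.2.1.1) ∨ IsSharedEdge (p.1.shift p.2.1.2, p.2.1.1)) ∧
      (IsSitePosEdge (p.1, p.2.1.2) ∨ IsSharedEdge (p.1, p.2.1.2)) := by
  obtain ⟨x, ⟨⟨i, j⟩, hij⟩⟩ := p
  have hj : j ≠ 0 := plaq_snd_ne_zero (x, ⟨(i, j), hij⟩)
  have hlt := ZMod.val_lt (x 0)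
  have hE := Nat.even_iff.mp hL
  have h1L : 1 < L := Fact.out
  unfold IsSitePosPlaq at hp
  simp only at hp hj ⊢
  simp only [IsSitePosEdge, IsSharedEdge, hj, ↓reduceIte, ne_eq, not_false_eq_true, true_and]
  by_cases hi : i = 0
  · subst hi
    simp only [↓reduceIte, not_true_eq_false, false_and, or_false] at hp ⊢
    rw [val_shift_self, val_shift_of_ne _ (Ne.symm hj)]
    refine ⟨hp, ?_, hp, ?_⟩
    · split_ifs <;> omega
    · omega
  · simp only [hi, ↓reduceIte, not_false_eq_true, true_and] at hp ⊢
    rw [val_shift_of_ne _ (Ne.symm hi), val_shift_of_ne _ (Ne.symm hj)]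
    omega

omit [Fact (1 < L)] in
omit [NeZero L] in
/-- The four links of a shared plaquette are shared. [folklore] -/
theorem edges_of_isSharedPlaq {p : Plaquette d L} (hp : IsSharedPlaq p) :
    IsSharedEdge (p.1, p.2.1.1) ∧ IsSharedEdge (p.1.shift p.2.1.1, p.2.1.2) ∧
      IsSharedEdge (p.1.shift p.2.1.2, p.2.1.1) ∧ IsSharedEdge (p.1, p.2.1.2) := by
  obtain ⟨x, ⟨⟨i, j⟩, hij⟩⟩ := p
  have hj : j ≠ 0 := plaq_snd_ne_zero (x, ⟨(i, j), hij⟩)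
  obtain ⟨hi, ht⟩ := hp
  simp only at hi ht hj ⊢
  simp only [IsSharedEdge, ne_eq, hi, hj, not_false_eq_true, true_and]
  rw [val_shift_of_ne _ (Ne.symm hi), val_shift_of_ne _ (Ne.symm hj)]
  exact ⟨ht, ht, ht, ht⟩

/-- The `P'`-coordinates of the reflected configuration depend only on the coordinates off `P'`
(hypothesis `hΘdep` of the abstract mechanism, with `C = ∅`). [folklore] -/
theorem dependsOn_negReflect_apply (hL : Even L) {G : Type*} [Group G] (e : Edge d L)
    (he : e ∈ (sitePosEdges ∪ ∅ : Finset (Edge d L))) :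
    DependsOn (fun U : GaugeConfig d L G => U.negReflect e)
      (((sitePosEdgesᶜ : Finset (Edge d L)) : Set (Edge d L))) := by
  intro U V hUV
  have hmem : siteEdgeReflect e ∈ ((sitePosEdgesᶜ : Finset (Edge d L)) : Set (Edge d L)) := by
    rw [Finset.mem_coe, Finset.mem_compl, mem_sitePosEdges]
    rw [Finset.union_empty, mem_sitePosEdges] at he
    exact not_isSitePosEdge_siteEdgeReflect hL he
  simp only [negReflect_apply, hUV _ hmem]

omit [Fact (1 < L)] in
/-- The reflection fixes the shared coordinates (hypothesis `hΘM`). [folklore] -/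
theorem negReflect_apply_of_mem_sharedEdges (hL : Even L) {G : Type*} [Group G]
    (U : GaugeConfig d L G) (e : Edge d L) (he : e ∈ (sharedEdges : Finset (Edge d L))) :
    U.negReflect e = U e := by
  rw [mem_sharedEdges] at he
  rw [negReflect_apply, if_neg he.1, siteEdgeReflect_of_isSharedEdge hL he]

end Classification2

/-! ## The Wilson action split into positive, negative and shared parts -/

section Action

variable {d L N : ℕ} [NeZero d] [NeZero L] [Fact (1 < L)]
variable {G : Type*} [Group G] [TopologicalSpace G] [IsTopologicalGroup G] [CompactSpace G]
  [MeasurableSpace G] [BorelSpace G]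
variable (ρ : G →* Matrix (Fin N) (Fin N) ℂ)

/-- The positive part `A'(U) = ∑_{p positive} Re tr ρ(U_p)` of the action. [folklore] -/
def sitePosAction (U : GaugeConfig d L G) : ℝ := ∑ p ∈ univ.filter IsSitePosPlaq, plaqRe ρ U p

/-- The shared part `S_M(U) = ∑_{p shared} Re tr ρ(U_p)` of the action. [folklore] -/
def sharedAction (U : GaugeConfig d L G) : ℝ := ∑ p ∈ univ.filter IsSharedPlaq, plaqRe ρ U p

omit [NeZero L] [Fact (1 < L)] [MeasurableSpace G] [BorelSpace G] in
/-- `Re tr ρ((Θ'U)_p) = Re tr ρ(U_{ϑ'p})`: the reflected holonomy is the holonomy of the reflected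
plaquette (spatial plaquettes) or a conjugate of its inverse (temporal plaquettes). [folklore] -/
theorem plaqRe_negReflect (hρ : Continuous ρ) (U : GaugeConfig d L G) (p : Plaquette d L) :
    plaqRe ρ U.negReflect p = plaqRe ρ U (sitePlaqReflect p) := by
  obtain ⟨x, ⟨⟨i, j⟩, hij⟩⟩ := p
  have hj : j ≠ 0 := plaq_snd_ne_zero (x, ⟨(i, j), hij⟩)
  unfold plaqRe sitePlaqReflect plaquetteHolonomy
  simp only [negReflect_apply, siteEdgeReflect, hj, ↓reduceIte]
  by_cases hi : i = 0
  · subst hi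
    simp only [↓reduceIte]
    rw [negReflect_shift_shift_zero _ hj, ← negReflect_shift_shift x]
    set y := (x.shift 0).negReflect
    rw [show (U (y, 0))⁻¹ * U (y, j) * ((U (y.shift j, 0))⁻¹)⁻¹ * (U (y.shift 0, j))⁻¹ =
        (U (y, 0))⁻¹ * (U (y, 0) * U (y.shift 0, j) * (U (y.shift j, 0))⁻¹ * (U (y, j))⁻¹)⁻¹ *
          ((U (y, 0))⁻¹)⁻¹ by group,
      Literature.RepresentationTheory.CompactGroups.CompactGroup.trace_conj_eq,
      Literature.RepresentationTheory.CompactGroups.CompactGroup.re_trace_map_inv ρ hρ]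
  · simp only [hi, ↓reduceIte]
    rw [negReflect_shift_of_ne _ hi, negReflect_shift_of_ne _ hj]

omit [MeasurableSpace G] [BorelSpace G] in
/-- The negative part of the action is the positive part of the reflected configuration. [folklore] -/
theorem sum_neg_eq_sitePosAction_negReflect (hL : Even L) (hρ : Continuous ρ) (U : GaugeConfig d L G) :
    ∑ p ∈ univ.filter IsSiteNegPlaq, plaqRe ρ U p = sitePosAction ρ U.negReflect := by
  unfold sitePosAction
  simp_rw [plaqRe_negReflect ρ hρ]
  symm
  refine Finset.sum_equiv sitePlaqReflectEquiv (fun p => ?_) (fun p _ => rfl)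
  simp only [Finset.mem_filter, Finset.mem_univ, true_and]
  exact (isSiteNegPlaq_sitePlaqReflect_iff hL p).symm

omit [MeasurableSpace G] [BorelSpace G] in
/-- `∑ₚ Re tr ρ(U_p) = A'(U) + A'(Θ'U) + S_M(U)`. [folklore] -/
theorem sum_plaqRe_eq_site (hL : Even L) (hρ : Continuous ρ) (U : GaugeConfig d L G) :
    ∑ p, plaqRe ρ U p = sitePosAction ρ U + sitePosAction ρ U.negReflect + sharedAction ρ U := by
  have h1 : ∑ p, plaqRe ρ U p = ∑ p ∈ univ.filter IsSitePosPlaq, plaqRe ρ U p +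
      ∑ p ∈ univ.filter (fun p => ¬ IsSitePosPlaq p), plaqRe ρ U p :=
    (Finset.sum_filter_add_sum_filter_not univ IsSitePosPlaq _).symm
  have h2 : ∑ p ∈ univ.filter (fun p => ¬ IsSitePosPlaq p), plaqRe ρ U p =
      ∑ p ∈ univ.filter IsSharedPlaq, plaqRe ρ U p + ∑ p ∈ univ.filter IsSiteNegPlaq, plaqRe ρ U p := by
    rw [← Finset.sum_filter_add_sum_filter_not (univ.filter fun p => ¬ IsSitePosPlaq p) IsSharedPlaq,
      Finset.filter_filter, Finset.filter_filter]
    have hC : (univ.filter fun p : Plaquette d L => ¬ IsSitePosPlaq p ∧ IsSharedPlaq p) =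
        univ.filter IsSharedPlaq :=
      Finset.filter_congr fun p _ => ⟨fun h => h.2, fun h => ⟨not_isSitePosPlaq_of_isSharedPlaq h, h⟩⟩
    have hN : (univ.filter fun p : Plaquette d L => ¬ IsSitePosPlaq p ∧ ¬ IsSharedPlaq p) =
        univ.filter IsSiteNegPlaq :=
      Finset.filter_congr fun p _ => Iff.rfl
    rw [hC, hN]
  rw [h1, h2, sum_neg_eq_sitePosAction_negReflect ρ hL hρ]
  unfold sitePosAction sharedAction
  ring

omit [MeasurableSpace G] [BorelSpace G] in
/-- `S = N·#plaquettes - A' - A' ∘ Θ' - S_M`. [folklore] -/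
theorem wilsonAction_siteSplit (hL : Even L) (hρ : Continuous ρ) (U : GaugeConfig d L G) :
    wilsonAction ρ U = N * Fintype.card (Plaquette d L) -
      (sitePosAction ρ U + sitePosAction ρ U.negReflect + sharedAction ρ U) := by
  rw [wilsonAction_eq, sum_plaqRe_eq_site ρ hL hρ]

omit [TopologicalSpace G] [IsTopologicalGroup G] [CompactSpace G] [MeasurableSpace G]
  [BorelSpace G] in
/-- The positive part of the action depends only on the links in `P' ∪ M`. [folklore] -/
theorem dependsOn_sitePosAction (hL : Even L) :
    DependsOn (sitePosAction (d := d) (L := L) ρ)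
      ((sitePosEdges ∪ sharedEdges : Finset (Edge d L)) : Set (Edge d L)) := by
  intro U V hUV
  unfold sitePosAction
  refine Finset.sum_congr rfl fun p hp => ?_
  rw [Finset.mem_filter] at hp
  obtain ⟨h1, h2, h3, h4⟩ := edges_of_isSitePosPlaq hL hp.2
  have h : ∀ e, IsSitePosEdge e ∨ IsSharedEdge e → U e = V e := fun e he => hUV e (by
    rcases he with he | he <;> simp [he])
  simp only [plaqRe, plaquetteHolonomy, h _ h1, h _ h2, h _ h3, h _ h4]

omit [Fact (1 < L)] [TopologicalSpace G] [IsTopologicalGroup G] [CompactSpace G] [MeasurableSpace G]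
  [BorelSpace G] in
/-- The shared part of the action depends only on the links in `M`. [folklore] -/
theorem dependsOn_sharedAction :
    DependsOn (sharedAction (d := d) (L := L) ρ)
      ((sharedEdges : Finset (Edge d L)) : Set (Edge d L)) := by
  intro U V hUV
  unfold sharedAction
  refine Finset.sum_congr rfl fun p hp => ?_
  rw [Finset.mem_filter] at hp
  obtain ⟨h1, h2, h3, h4⟩ := edges_of_isSharedPlaq hp.2
  have h : ∀ e, IsSharedEdge e → U e = V e := fun e he => hUV e (by simp [he])
  simp only [plaqRe, plaquetteHolonomy, h _ h1, h _ h2, h _ h3, h _ h4]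

omit [Fact (1 < L)] [TopologicalSpace G] [IsTopologicalGroup G] [CompactSpace G] [MeasurableSpace G]
  [BorelSpace G] in
/-- The shared part of the action is reflection invariant. [folklore] -/
theorem sharedAction_negReflect (hL : Even L) (U : GaugeConfig d L G) :
    sharedAction ρ U.negReflect = sharedAction ρ U :=
  dependsOn_sharedAction ρ fun e he => negReflect_apply_of_mem_sharedEdges hL U e (Finset.mem_coe.1 he)

omit [Fact (1 < L)] [MeasurableSpace G] [BorelSpace G] in
/-- `|A'(U)| ≤ N · #plaquettes`. [folklore] -/
theorem abs_sitePosAction_le (hρ : Continuous ρ) (U : GaugeConfig d L G) :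
    |sitePosAction ρ U| ≤ N * Fintype.card (Plaquette d L) := by
  unfold sitePosAction
  calc |∑ p ∈ univ.filter IsSitePosPlaq, plaqRe ρ U p| ≤ ∑ p ∈ univ.filter IsSitePosPlaq, |plaqRe ρ U p| :=
        Finset.abs_sum_le_sum_abs _ _
    _ ≤ ∑ _p ∈ univ.filter IsSitePosPlaq, (N : ℝ) := Finset.sum_le_sum fun p _ => abs_plaqRe_le ρ hρ U p
    _ ≤ ∑ _p : Plaquette d L, (N : ℝ) :=
        Finset.sum_le_sum_of_subset_of_nonneg (Finset.filter_subset _ _) fun _ _ _ => Nat.cast_nonneg _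
    _ = N * Fintype.card (Plaquette d L) := by
        rw [Finset.sum_const, Finset.card_univ, nsmul_eq_mul, mul_comm]

omit [Fact (1 < L)] [MeasurableSpace G] [BorelSpace G] in
/-- `|S_M(U)| ≤ N · #plaquettes`. [folklore] -/
theorem abs_sharedAction_le (hρ : Continuous ρ) (U : GaugeConfig d L G) :
    |sharedAction ρ U| ≤ N * Fintype.card (Plaquette d L) := by
  unfold sharedAction
  calc |∑ p ∈ univ.filter IsSharedPlaq, plaqRe ρ U p|
        ≤ ∑ p ∈ univ.filter IsSharedPlaq, |plaqRe ρ U p| := Finset.abs_sum_le_sum_abs _ _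
    _ ≤ ∑ _p ∈ univ.filter IsSharedPlaq, (N : ℝ) :=
        Finset.sum_le_sum fun p _ => abs_plaqRe_le ρ hρ U p
    _ ≤ ∑ _p : Plaquette d L, (N : ℝ) :=
        Finset.sum_le_sum_of_subset_of_nonneg (Finset.filter_subset _ _) fun _ _ _ => Nat.cast_nonneg _
    _ = N * Fintype.card (Plaquette d L) := by
        rw [Finset.sum_const, Finset.card_univ, nsmul_eq_mul, mul_comm]

omit [Fact (1 < L)] [CompactSpace G] in
/-- The positive part of the action is measurable. [folklore] -/
theorem measurable_sitePosAction (hρ : Continuous ρ) :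
    Measurable (sitePosAction (d := d) (L := L) (G := G) ρ) :=
  Finset.measurable_sum _ fun p _ => measurable_plaqRe ρ hρ p

omit [Fact (1 < L)] [CompactSpace G] in
/-- The shared part of the action is measurable. [folklore] -/
theorem measurable_sharedAction (hρ : Continuous ρ) :
    Measurable (sharedAction (d := d) (L := L) (G := G) ρ) :=
  Finset.measurable_sum _ fun p _ => measurable_plaqRe ρ hρ p

end Action

/-! ## Measure preservation and the observable `g = F e^{βA'} e^{βS_M/2}` -/

section Measure

variable {d L N : ℕ} [NeZero d] [NeZero L] [Fact (1 < L)]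
variable {G : Type*} [Group G] [TopologicalSpace G] [IsTopologicalGroup G] [CompactSpace G]
  [MeasurableSpace G] [BorelSpace G]
variable (ρ : G →* Matrix (Fin N) (Fin N) ℂ)

omit [NeZero L] [Fact (1 < L)] [CompactSpace G] in
/-- The reflection `Θ'` on configurations is measurable. [folklore] -/
theorem measurable_negReflect :
    Measurable (GaugeConfig.negReflect : GaugeConfig d L G → GaugeConfig d L G) := by
  refine measurable_pi_lambda _ fun e => ?_
  simp only [negReflect_apply]
  split_ifs
  · exact (measurable_pi_apply _).inv
  · exact measurable_pi_apply _

omit [Fact (1 < L)] in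
/-- **`Θ'` preserves the product Haar measure** (relabelling by an involution and inversion of the
temporal link variables; Haar measure on the compact group is inversion invariant). [folklore] -/
theorem measurePreserving_negReflect :
    MeasurePreserving (GaugeConfig.negReflect : GaugeConfig d L G → GaugeConfig d L G)
      (LatticeRP.piMeasure (haarProbability G)) (LatticeRP.piMeasure (haarProbability G)) := by
  have h1 : MeasurePreserving
      (MeasurableEquiv.arrowCongr' (siteEdgeReflectEquiv (d := d) (L := L)) (MeasurableEquiv.refl G))
      (LatticeRP.piMeasure (haarProbability G)) (LatticeRP.piMeasure (haarProbability G)) :=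
    measurePreserving_arrowCongr' (fun _ => haarProbability G) (fun _ => haarProbability G)
      siteEdgeReflectEquiv (MeasurableEquiv.refl G) fun _ => MeasurePreserving.id _
  have h2 : MeasurePreserving
      (fun (V : GaugeConfig d L G) (e : Edge d L) =>
        (if e.2 = 0 then (fun g : G => g⁻¹) else id) (V e))
      (LatticeRP.piMeasure (haarProbability G)) (LatticeRP.piMeasure (haarProbability G)) := by
    refine measurePreserving_pi _ _ fun e => ?_
    split_ifs
    · exact Measure.measurePreserving_inv _
    · exact MeasurePreserving.id _
  have heq : (GaugeConfig.negReflect : GaugeConfig d L G → GaugeConfig d L G) =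
      (fun (V : GaugeConfig d L G) (e : Edge d L) =>
        (if e.2 = 0 then (fun g : G => g⁻¹) else id) (V e)) ∘
      (MeasurableEquiv.arrowCongr' (siteEdgeReflectEquiv (d := d) (L := L)) (MeasurableEquiv.refl G)) := by
    funext U e
    have happ : (MeasurableEquiv.arrowCongr' (siteEdgeReflectEquiv (d := d) (L := L))
        (MeasurableEquiv.refl G)) U e = U (siteEdgeReflect e) := rfl
    simp only [Function.comp_apply, negReflect_apply, happ]
    split_ifs <;> rfl
  rw [heq]
  exact h2.comp h1

/-- The observable `g = F · exp(β A') · exp(β S_M / 2)`. [folklore] -/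
def siteObs (β : ℝ) (F : GaugeConfig d L G → ℂ) (V : GaugeConfig d L G) : ℂ :=
  F V * (Real.exp (β * sitePosAction ρ V + β / 2 * sharedAction ρ V) : ℂ)

omit [Fact (1 < L)] [CompactSpace G] in
/-- `g` is measurable. [folklore] -/
theorem measurable_siteObs (hρ : Continuous ρ) (β : ℝ) {F : GaugeConfig d L G → ℂ}
    (hF : Measurable F) : Measurable (siteObs ρ β F) :=
  hF.mul (Complex.measurable_ofReal.comp
    (((measurable_sitePosAction ρ hρ).const_mul β).add
      ((measurable_sharedAction ρ hρ).const_mul (β / 2))).exp)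

omit [Fact (1 < L)] [MeasurableSpace G] [BorelSpace G] in
/-- `g` is bounded. [folklore] -/
theorem norm_siteObs_le (hρ : Continuous ρ) (β : ℝ) {F : GaugeConfig d L G → ℂ}
    {CF : ℝ} (hFb : ∀ U, ‖F U‖ ≤ CF) (V : GaugeConfig d L G) :
    ‖siteObs ρ β F V‖ ≤ |CF| * Real.exp ((|β| + |β / 2|) * (N * Fintype.card (Plaquette d L))) := by
  rw [siteObs, norm_mul, Complex.norm_real, Real.norm_eq_abs, abs_of_pos (Real.exp_pos _)]
  refine mul_le_mul ((hFb V).trans (le_abs_self _)) ?_ (Real.exp_pos _).le (abs_nonneg _)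
  refine Real.exp_le_exp.2 ?_
  rw [add_mul]
  refine add_le_add ?_ ?_
  · calc β * sitePosAction ρ V ≤ |β * sitePosAction ρ V| := le_abs_self _
      _ = |β| * |sitePosAction ρ V| := abs_mul _ _
      _ ≤ |β| * (N * Fintype.card (Plaquette d L)) :=
          mul_le_mul_of_nonneg_left (abs_sitePosAction_le ρ hρ V) (abs_nonneg _)
  · calc β / 2 * sharedAction ρ V ≤ |β / 2 * sharedAction ρ V| := le_abs_self _
      _ = |β / 2| * |sharedAction ρ V| := abs_mul _ _
      _ ≤ |β / 2| * (N * Fintype.card (Plaquette d L)) :=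
          mul_le_mul_of_nonneg_left (abs_sharedAction_le ρ hρ V) (abs_nonneg _)

omit [TopologicalSpace G] [IsTopologicalGroup G] [CompactSpace G] [MeasurableSpace G]
  [BorelSpace G] in
/-- `g` depends only on the links in `P' ∪ M` (stated for `P' ∪ ∅ ∪ M`). [folklore] -/
theorem dependsOn_siteObs (hL : Even L) (β : ℝ) {F : GaugeConfig d L G → ℂ}
    (hFdep : DependsOn F ((sitePosEdges ∪ sharedEdges : Finset (Edge d L)) : Set (Edge d L))) :
    DependsOn (siteObs ρ β F) ((sitePosEdges ∪ ∅ ∪ sharedEdges : Finset (Edge d L)) : Set (Edge d L)) := by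
  intro U V hUV
  rw [Finset.union_empty] at hUV
  have hM : ∀ e ∈ ((sharedEdges : Finset (Edge d L)) : Set (Edge d L)), U e = V e := fun e he =>
    hUV e (by rw [Finset.coe_union]; exact Or.inr he)
  simp only [siteObs, hFdep hUV, dependsOn_sitePosAction ρ hL hUV, dependsOn_sharedAction ρ hM]

end Measure

/-! ## Assembly -/

section Assembly

variable {d L N : ℕ} [NeZero d] [NeZero L] [Fact (1 < L)]
variable {G : Type*} [Group G] [TopologicalSpace G] [IsTopologicalGroup G] [CompactSpace G]
  [MeasurableSpace G] [BorelSpace G]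
variable (ρ : G →* Matrix (Fin N) (Fin N) ℂ)

omit [MeasurableSpace G] [BorelSpace G] in
/-- **The pointwise identity**: `e^{-βS(U)} conj F(Θ'U) F(U) = e^{-βN#plaq} g(U) conj g(Θ'U)`.
[folklore] -/
theorem siteIntegrand_eq (hL : Even L) (hρ : Continuous ρ) (β : ℝ) (F : GaugeConfig d L G → ℂ)
    (U : GaugeConfig d L G) :
    (Real.exp (-β * wilsonAction ρ U) : ℂ) * (conj (F U.negReflect) * F U) =
      (Real.exp (-β * (N * Fintype.card (Plaquette d L))) : ℂ) *
        (siteObs ρ β F U * conj (siteObs ρ β F U.negReflect)) := by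
  rw [wilsonAction_siteSplit ρ hL hρ U]
  unfold siteObs
  rw [sharedAction_negReflect ρ hL U]
  simp only [map_mul, Complex.conj_ofReal]
  rw [show -β * (↑N * ↑(Fintype.card (Plaquette d L)) -
        (sitePosAction ρ U + sitePosAction ρ U.negReflect + sharedAction ρ U)) =
      -β * (↑N * ↑(Fintype.card (Plaquette d L))) +
        (β * sitePosAction ρ U + β / 2 * sharedAction ρ U) +
        (β * sitePosAction ρ U.negReflect + β / 2 * sharedAction ρ U) by ring,
    Real.exp_add, Real.exp_add]
  push_cast
  ring

/-- **Reflection positivity (through sites) of the un-normalised Wilson weight**: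
`0 ≤ ∫ exp(-β S(U)) conj F(Θ'U) F(U) ∏ dU_e` for `F` bounded measurable depending only on the
links of the closed positive-time half, and every real `β`. [folklore] -/
theorem integral_siteIntegrand_nonneg (hL : Even L) (hρ : Continuous ρ) (β : ℝ)
    {F : GaugeConfig d L G → ℂ} (hF : Measurable F) {CF : ℝ} (hFb : ∀ U, ‖F U‖ ≤ CF)
    (hFdep : DependsOn F ((sitePosEdges ∪ sharedEdges : Finset (Edge d L)) : Set (Edge d L))) :
    0 ≤ ∫ U : GaugeConfig d L G, (Real.exp (-β * wilsonAction ρ U) : ℂ) *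
      (conj (F (GaugeConfig.negReflect U)) * F U) ∂(LatticeRP.piMeasure (haarProbability G)) := by
  set μ : Measure (GaugeConfig d L G) := LatticeRP.piMeasure (haarProbability G) with hμ
  simp_rw [siteIntegrand_eq ρ hL hρ β F]
  rw [integral_const_mul]
  refine mul_nonneg (Complex.zero_le_real.2 (Real.exp_pos _).le) ?_
  have key := LatticeRP.integral_splice_mul_conj_comp_of_shared_nonneg (haarProbability G)
    sharedEdges sitePosEdges (∅ : Finset (Edge d L)) GaugeConfig.negReflect
    measurePreserving_negReflect
    (fun U e he => negReflect_apply_of_mem_sharedEdges hL U e he)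
    (fun e he => dependsOn_negReflect_apply hL e he) disjoint_sharedEdges_sitePosEdges
    (Finset.disjoint_empty_right _) (measurable_siteObs ρ hρ β hF) (norm_siteObs_le ρ hρ β hFb)
    (dependsOn_siteObs ρ hL β hFdep)
  have hsplice : ∀ p : GaugeConfig d L G × GaugeConfig d L G,
      LatticeRP.splice (∅ : Finset (Edge d L)) p = p.1 := fun p => by
    funext i
    simp [LatticeRP.splice_apply]
  simp_rw [hsplice] at key
  rw [integral_fun_fst (fun U : GaugeConfig d L G =>
      siteObs ρ β F U * conj (siteObs ρ β F (GaugeConfig.negReflect U))), probReal_univ, one_smul] at key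
  exact key

end Assembly

end WilsonSiteRP

/-! ## The theorem -/

section Main

variable {d L N : ℕ} {G : Type*} [Group G] [TopologicalSpace G] [IsTopologicalGroup G]
  [CompactSpace G] [MeasurableSpace G] [BorelSpace G] (ρ : G →* Matrix (Fin N) (Fin N) ℂ)

/-- **Osterwalder–Seiler reflection positivity in hyperplanes through sites** (the "through
sites" part of constructive-qft.S13; K. Osterwalder, E. Seiler, *Gauge field theories on a
lattice*, Ann. Phys. 110 (1978) 440–471, §2; E. Seiler, LNP 159 (1982), Ch. 2; Fröhlich–Israel–
Lieb–Simon, Comm. Math. Phys. 62 (1978) 1, Thm. 2.1). For a compact group `G`, a continuous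
matrix representation `ρ`, ANY real `β`, the torus `(ℤ/Lℤ)^d` with `L` even and the reflection
`θ' t = -t` in the hyperplanes `t = 0`, `t = L/2` through lattice sites:
`⟨conj F(Θ'U) · F(U)⟩_{Λ,β} ≥ 0` (real and non-negative) for every bounded measurable observable
`F` depending only on the links of the closed positive-time half `0 ≤ t ≤ L/2`
(`WilsonSiteRP.sitePosEdges ∪ WilsonSiteRP.sharedEdges`: temporal links `t → t+1` with `t < L/2`,
spatial links with `0 ≤ t ≤ L/2`). No sign condition on `β` is needed because every plaquette lies
in one closed half. [folklore] -/
theorem wilsonExpectation_siteReflectionPositive [NeZero d] [NeZero L] (hL : Even L)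
    (hρ : Continuous ρ) (β : ℝ) (F : GaugeConfig d L G → ℂ) (hF : Measurable F)
    (hFb : ∃ C : ℝ, ∀ U, ‖F U‖ ≤ C)
    (hFdep : DependsOn F
      ((WilsonSiteRP.sitePosEdges ∪ WilsonSiteRP.sharedEdges : Finset (Edge d L)) : Set (Edge d L))) :
    0 ≤ wilsonExpectation ρ β fun U => conj (F U.negReflect) * F U := by
  haveI : Fact (1 < L) := ⟨by
    obtain ⟨r, hr⟩ := hL
    have := NeZero.ne L
    omega⟩
  obtain ⟨CF, hFb⟩ := hFb
  have hdens : Measurable fun U : GaugeConfig d L G =>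
      ENNReal.ofReal (Real.exp (-β * wilsonAction ρ U)) :=
    ENNReal.measurable_ofReal.comp ((WilsonRP.measurable_wilsonAction ρ hρ).const_mul (-β)).exp
  unfold wilsonExpectation wilsonMeasure
  rw [integral_smul_measure]
  unfold wilsonWeight
  rw [integral_withDensity_eq_integral_toReal_smul hdens (ae_of_all _ fun _ => ENNReal.ofReal_lt_top)]
  simp_rw [ENNReal.toReal_ofReal (Real.exp_nonneg _), Complex.real_smul]
  refine mul_nonneg (Complex.zero_le_real.2 ENNReal.toReal_nonneg) ?_
  exact WilsonSiteRP.integral_siteIntegrand_nonneg ρ hL hρ β hF hFb hFdep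

end Main

end

end Literature.MathematicalPhysics.QuantumFieldTheory
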